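import Mathlib
import Literature.NumberTheory.Automorphic.EigenvarietyResGLn

/-!
# Sketch — first lemmas of the crux ideas for `WeightVelocity` (stmt-Langlands-13450), ideator 3

Namespace mirrors the crux protocol (`Cruxes/WeightVelocity/<Slug>`); nothing here is filed.
-/

noncomputable section

open scoped NumberField
open IsDedekindDomain Literature.NumberTheory.Automorphic

namespace Summit.Langlands.Langlands.Cruxes.WeightVelocity

/-! ## Idea `purity-wall` (impure classical weights carry no cusp forms) -/
namespace PurityWall

variable {K : Type} [Field K] [NumberField K] {n p : ℕ} [Fact p.Prime]
  {S : Set (HeightOneSpectrum (𝓞 K))}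

/-- **Relative wall at the gap `(v; i, j)`** (the posited package; in print: Hansen 2017 Thm 4.5.1(ii)
run over the hyperplane `{gap_{v,i,j} = gap_{v,i,j}(x)}` of weight space, with Barrera Salazar–Williams
2021 Lemma 5.14 / Prop. 5.15 for the propagation of strong interiority, and Clozel purity / Borel–Wallach
for the vanishing of cuspidal cohomology at impure weights): an irreducible component through `x` on
which the gap character `κ_{v,i} κ_{v,j}⁻¹` is CONSTANT has dimension `≤ d − d_v − 1`
(`d` = dim of weight space, `d_v = [K_v : ℚ_p]`). -/
def HasRelativeWallAt (E : EigenvarietyResGLn K n p S) (d : ℕ) (x : E.Pt) (v : PlacesOver K p)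
    (i j : Fin n) : Prop :=
  ∀ C ∈ irreducibleComponents E.Pt, x ∈ C →
    (∀ y ∈ C, ∀ u : (v.1.adicCompletionIntegers K)ˣ,
        E.weight y v i u / E.weight y v j u = E.weight x v i u / E.weight x v j u) →
      topologicalKrullDim C + ((v.1.asIdeal.ramificationIdx ℤ * v.1.asIdeal.inertiaDeg ℤ : ℕ) : WithBot ℕ∞)
        + 1 ≤ (d : WithBot ℕ∞)

/-- **First lemma of the line (provable now, pure bookkeeping):** Newton's lower bound
`dim C ≥ d − l(x)` and the relative wall force the gap at `(v; i, j)` to MOVE on every irreducible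
component through `x` as soon as `l(x) ≤ d_v` — the zero-slack / Bianchi corner `l₀ = 1 = d_v`
(`n = 2`, `K` imaginary quadratic, `p` split), where it is exactly the leading-jet content of clause
(iii) of `WeightVelocity` for `d_v = 1`. -/
def GapMovesOnComponents : Prop :=
  ∀ (K : Type) [Field K] [NumberField K] (n p : ℕ) [Fact p.Prime]
    (S : Set (HeightOneSpectrum (𝓞 K))) (E : EigenvarietyResGLn K n p S) (d : ℕ) (x : E.Pt)
    (v : PlacesOver K p) (i j : Fin n),
    E.HasNewtonBoundWith d →
    E.defect x ≤ v.1.asIdeal.ramificationIdx ℤ * v.1.asIdeal.inertiaDeg ℤ →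
    E.defect x ≤ d →
    HasRelativeWallAt E d x v i j →
      ∀ C ∈ irreducibleComponents E.Pt, x ∈ C →
        ∃ y ∈ C, ∃ u : (v.1.adicCompletionIntegers K)ˣ,
          E.weight y v i u / E.weight y v j u ≠ E.weight x v i u / E.weight x v j u

/-- **Arc detection** (the bridge from "the gap moves on the germ" to "some formal arc has a non-zero
leading gap jet", i.e. to clause (iii) verbatim for `d_v = 1`): in a complete local noetherian domain
over a field, every non-zero element survives along some formal arc.  (Cohen structure + finiteness of
normalisation of complete local domains; Mathlib lacks Cohen's theorem, so this is a statement only.) -/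
def ArcsDetect : Prop :=
  ∀ (k R : Type) [Field k] [CommRing R] [IsDomain R] [IsNoetherianRing R] [IsLocalRing R]
    [Algebra k R] [IsAdicComplete (IsLocalRing.maximalIdeal R) R],
    Module.Finite k (IsLocalRing.ResidueField R) →
    ∀ f : R, f ≠ 0 → f ∈ IsLocalRing.maximalIdeal R →
      ∃ (k' : Type) (_ : Field k') (_ : Algebra k k') (_ : FiniteDimensional k k')
        (φ : R →ₐ[k] PowerSeries k'), φ f ≠ 0 ∧ ∀ r ∈ IsLocalRing.maximalIdeal R,
          PowerSeries.constantCoeff (φ r) = 0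


/-- Key arithmetic for `GapMovesOnComponents`: in `WithBot ℕ∞`, `a + dv + 1 ≤ d` and `d - l ≤ a` with
`l ≤ dv` is absurd. -/
lemma absurd_of_bounds {a : WithBot ℕ∞} {d dv l : ℕ} (h1 : a + (dv : WithBot ℕ∞) + 1 ≤ (d : WithBot ℕ∞))
    (h2 : ((d - l : ℕ) : WithBot ℕ∞) ≤ a) (hl : l ≤ dv) : False := by
  induction a using WithBot.recBotCoe with
  | bot => exact absurd h2 (by simp)
  | coe a =>
    induction a using ENat.recTopCoe with
    | top =>
      have : ((⊤ : ℕ∞) : WithBot ℕ∞) + (dv : WithBot ℕ∞) + 1 = ((⊤ : ℕ∞) : WithBot ℕ∞) := by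
        rw [← WithBot.coe_natCast, ← WithBot.coe_one, ← WithBot.coe_add, ← WithBot.coe_add]
        simp
      rw [this] at h1
      have h1' : ((⊤ : ℕ∞) : WithBot ℕ∞) ≤ ((d : ℕ∞) : WithBot ℕ∞) := by simpa using h1
      rw [WithBot.coe_le_coe] at h1'
      exact absurd h1' (by simp)
    | coe a =>
      have e1 : (((a : ℕ∞) : WithBot ℕ∞) + (dv : WithBot ℕ∞) + 1) = (((a + dv + 1 : ℕ) : ℕ∞) : WithBot ℕ∞) := by
        push_cast; ring
      rw [e1] at h1
      have h1' : (((a + dv + 1 : ℕ) : ℕ∞) : WithBot ℕ∞) ≤ (((d : ℕ) : ℕ∞) : WithBot ℕ∞) := by simpa using h1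
      rw [WithBot.coe_le_coe, ENat.coe_le_coe] at h1'
      have h2' : d ≤ a + l := by simpa using h2
      omega

/-- **The first lemma of the purity-wall line is provable now** (and proved): Newton's bound plus the
relative wall force the gap to move on every component through `x` when `l(x) ≤ d_v`. [folklore] -/
theorem gapMovesOnComponents_holds : GapMovesOnComponents := by
  intro K _ _ n p _ S E d x v i j hN hl _hd hW C hC hx
  by_contra h
  push Not at h
  exact absurd_of_bounds (hW C hC hx h) (hN x C hC hx) hl

end PurityWall

/-! ## Idea `derived-diamond-duality` (velocity ⟺ containment of derived diamond operators) -/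
namespace DerivedDiamondDuality

/-- **First lemma (provable now, linear algebra):** for a linear map `a` on `T = G × R` (the degree-one
derived diamond action `∂` on `Hom(T(ℤ_p), E) = T_κ 𝒲`, split into the `(v,i)`-gap directions `G` and
the rest `R`), the projection of `ker a` onto `G` is everything iff `a(G) ⊆ a(R)`.  With
`ker ∂ = T_x 𝒳` (Khare–Ronchetti 2023 Lemma 5.5 / Hansen–Thorne 2017 Thm 4.9, given unramifiedness of
the weight map at `x`), the left side is full weight velocity at `(v, i)` to first order. -/
def VelocityIffDiamondContainment : Prop :=
  ∀ (F : Type) [Field F] (G R M : Type) [AddCommGroup G] [Module F G] [AddCommGroup R] [Module F R]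
    [AddCommGroup M] [Module F M] (a : G × R →ₗ[F] M),
    Submodule.map (LinearMap.fst F G R) (LinearMap.ker a) = ⊤ ↔
      Submodule.map (a ∘ₗ LinearMap.inl F G R) ⊤ ≤ Submodule.map (a ∘ₗ LinearMap.inr F G R) ⊤

/-- The cotangent form of "`θ` acts trivially iff `θ ∈ T_x 𝒳`": for a subspace `N` (the conormal
image of `I/𝔪I` in `𝔪/𝔪² = T*_κ𝒲`) of a vector space `V`, a functional `θ ∈ V*` (a tangent vector,
i.e. a degree-one derived diamond operator) kills `N` iff it lies in the dual annihilator of `N`; the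
derived diamond action in degree one is the restriction map `V* → N*` (Khare–Ronchetti Lemma 5.5). -/
def DiamondKernelIsAnnihilator : Prop :=
  ∀ (F : Type) [Field F] (V : Type) [AddCommGroup V] [Module F V] (N : Submodule F V),
    LinearMap.ker (N.subtype.dualMap) = N.dualAnnihilator

theorem diamondKernelIsAnnihilator_holds : DiamondKernelIsAnnihilator := by
  intro F _ V _ _ N
  exact LinearMap.ker_dualMap_eq_dualAnnihilator_range _ |>.trans (by rw [Submodule.range_subtype])

end DerivedDiamondDuality

end Summit.Langlands.Langlands.Cruxes.WeightVelocity

end
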